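import Literature.Computability.QuantumComplexity.OutOfTimeOrderCorrelator
import Mathlib.LinearAlgebra.Matrix.Kronecker
import HarnessLib

/-!
# Pauli channels: error rates, eigenvalues, and the Bell-probe (entanglement-enhanced) read-out

Topic `Literature/InformationTheory/QuantumLearning` (next to `ClassicalShadows.lean`), built on the
tree's qubit-register Pauli vocabulary (`Pauli`, `pauliString`, `pauliCoeff`, the commutation sign
`strSign a b = (−1)^{⟨a,b⟩}` and its character orthogonality, `Literature/Computability/
QuantumComplexity/Pauli*.lean`).  The objects of Pauli-channel learning as printed by
Chen–Zhou–Seif–Jiang, *Quantum advantages for Pauli channel estimation*, Phys. Rev. A **105**,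
032435 (2022) §II and by Seif et al., *Entanglement-enhanced learning of quantum processes at
scale*, Nat. Commun. (2026) = arXiv:2408.03376, Methods §A and Supplementary Note §I.A:

"An `n`-qubit Pauli channel `Λ` is a quantum channel of the following form
`Λ(·) = Σ_{a ∈ ℤ₂^{2n}} p_a P_a(·)P_a` (1), where `p := {p_a}` is called the Pauli error rates.  An
important property of Pauli channels is that their eigen-operators are exactly the `4ⁿ` Pauli
operators.  Thus, an alternative expression for `Λ` is `Λ(·) = 2^{−n} Σ_b λ_b Tr(P_b(·)) P_b` (2),
where `λ := {λ_b}` is called the Pauli eigenvalues … related by the Walsh–Hadamard transform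
`λ_b = Σ_a p_a(−1)^{⟨a,b⟩}`, `p_a = 4^{−n} Σ_b λ_b(−1)^{⟨a,b⟩}` (3)"
[cite: ChenZhouSeifJiang2022, §II eqs. (1)–(3)]; "When an `n`-qubit ancillary system is available, a
simple protocol is as follows: prepare `n` Bell pairs, input one qubit from each pair to the Pauli
channel, and apply a Bell measurement on the output.  Since the Pauli channel can be viewed as
randomly applying one of the `4ⁿ` Pauli operators `P_a` with probability `p_a`, and each `P_a` is
mapped to a unique measurement outcome, we are effectively sampling from the probability
distribution `p`" [cite: ChenZhouSeifJiang2022, §II (Upper bounds) and eq. (4)]; "`Φ⁺ := |Φ⁺⟩⟨Φ⁺| =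
4^{−n} Σ_a P_a ⊗ P_aᵀ` (3) … `|Φ_b⟩ := P_b ⊗ I|Φ⁺⟩` … `Φ_b = 4^{−n} Σ_a (−1)^{⟨a,b⟩} P_a ⊗ P_aᵀ` (4).
Consider the following experiment: Prepare `|Φ⁺⟩_{SA}`, apply `Λ` on system `S`, then measure the
whole system with the Bell basis.  The probability of getting measurement outcome `b` is
`Pr[b] = Tr[Φ_b(Λ_S ⊗ 1_A(Φ⁺))] = 4^{−n} Σ_a (−1)^{⟨a,b⟩} λ_a` (5).  Comparing this to the
Walsh–Hadamard transform, one can realize that `Pr[b]` is exactly the Pauli error rates `p` of `Λ`.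
Specifically, `λ_a = Σ_b (−1)^{⟨a,b⟩} Pr[b]` (6)" [cite: SeifEtAl2026, Supplementary §I.A eqs. (3)–(6)].

## Contents (all proved, 0 named facts)

* `pauliChannel p ρ = Σ_a p_a P_a ρ P_a`, `pauliEigenvalue p b = Σ_a p_a · strSign a b`;
  **`pauliChannel_pauliString`** (`Λ(P_b) = λ_b P_b`: the Pauli strings are the eigen-operators),
  **`pauliChannel_eq_sum_eigenvalue`** (eq. (2), from the tree's Pauli expansion
  `eq_inv_smul_sum_pauliCoeff_smul`), **`walshHadamard_inversion`** (eq. (3):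
  `p_a = 4^{−n} Σ_b λ_b(−1)^{⟨a,b⟩}`, from the tree's character orthogonality
  `sum_strSign_mul_strSign`), `trace_pauliChannel` (trace preservation when `Σ p_a = 1`),
  linearity (`pauliChannel_add/_smul/_sum`).
* The doubled register `(ι → Bool) × (ι → Bool)` (system ⊗ memory) with Mathlib's Kronecker
  product `⊗ₖ`: `bellState` (`Φ⁺`, entries `2^{−n}[x₁ = x₂][y₁ = y₂]`), `trace_bellState`,
  **`bellState_mul_kronecker_one_mul_bellState`** (the superdense-coding identity
  `Φ⁺(A ⊗ 1)Φ⁺ = 2^{−n}Tr(A)·Φ⁺`), `bellState_mul_bellState`, **`bellState_eq_sum_kronecker`**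
  (Seif (3) / Chen (A1): `Φ⁺ = 4^{−n} Σ_a P_a ⊗ P_aᵀ`, from the tree's entrywise completeness
  `sum_pauliString_apply_mul_apply`); `bellBasis b = (P_b ⊗ 1)Φ⁺(P_b ⊗ 1)`,
  **`bellBasis_eq_sum_kronecker`** (Seif (4)), **`bellBasis_mul_bellBasis`** /
  `trace_bellBasis_mul_bellBasis` (orthonormality `Tr(Φ_bΦ_{b'}) = [b = b']`), `bellBasis_mul_self`,
  `trace_bellBasis`, **`sum_bellBasis`** (completeness `Σ_b Φ_b = 1`: the `4ⁿ` Bell states are an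
  orthonormal basis of the `2n`-qubit space).
* `channelOnSystem p ρ = Σ_a p_a (P_a ⊗ 1)ρ(P_a ⊗ 1)` with `channelOnSystem_kronecker`
  (`= Λ(A) ⊗ B` on product operators, i.e. `Λ_S ⊗ 1_A`), `channelOnSystem_bellState`
  (`(Λ ⊗ 1)(Φ⁺) = Σ_a p_a Φ_a`), and the read-out theorem
  **`trace_bellBasis_mul_channelOnSystem_bellState`**: `Tr[Φ_b (Λ_S ⊗ 1_A)(Φ⁺)] = p_b` (Seif (5):
  one Bell measurement on `n` Bell pairs samples the error distribution `p` exactly), with the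
  estimator identity `pauliEigenvalue_eq_sum_bellOutcome` (Seif (6)).

Not covered (scope caveats): the sample-complexity statements themselves (Chen et al. Thm 1:
`O(n ε^{−2} log δ^{−1})` Bell samples give all `λ_b` to `±ε`; the ancilla-free lower bounds
Thms 3–4, 6, 8 of `Ω(2^{n/3})` / `Ω(n2ⁿ)` measurements; Seif et al.'s hypothesis-testing bound
`p_s ≤ ½ + 0.43·M·2^{−n}`), noisy Bell pairs and the SPAM-robust EMEEL protocol (Seif et al.
Supplementary §I.B), `k < n` ancillas with stabilizer coverings, and anything about a device.

(pub-qadeq lane context, CLAIMS row E-54 — Seif et al.'s 'entanglement-enhanced learning' on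
IBM Eagle processors, "an overhead factor of 1.33 ± 0.05 per qubit, much smaller than the
fundamental lower bound of 2 without entanglement with quantum memory", CERTIFIED in its access
model; cited with E-53/E-55: this file is the tree vocabulary for WHAT is learned (`p`, `λ`, their
Walsh–Hadamard duality) and WHY one Bell measurement per channel use suffices with memory (the
read-out identity (5)); it formalizes no lower bound and no separation.  HONEST FRAMING:
instance-level adjudication of specific advantage claims; no claim about BQP vs BPP or the summit —
this file is finite-dimensional linear algebra and says nothing about any experiment.)

## References

* S. Chen, S. Zhou, A. Seif, L. Jiang, *Quantum advantages for Pauli channel estimation*, Phys. Rev.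
  A **105**, 032435 (2022), arXiv:2108.08488 — §II eqs. (1)–(4), (8); App. A eq. (A1) (numbering of
  the arXiv text).  [ChenZhouSeifJiang2022]
* A. Seif, S. Chen, S. Majumder, H. Liao, D. S. Wang, M. Malekakhlagh, A. Javadi-Abhari, L. Jiang,
  Z. K. Minev, *Entanglement-enhanced learning of quantum processes at scale*, Nat. Commun. (2026),
  doi:10.1038/s41467-026-75553-0, arXiv:2408.03376 — Methods §A eqs. (10)–(12); Supplementary §I.A
  eqs. (2)–(6) (arXiv v1 pp. 9, 15–16).  [SeifEtAl2026]
* Tree: `PauliExpansion.lean`, `PauliParseval.lean` (`trace_pauliString_mul_pauliString`,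
  `sum_pauliString_apply_mul_apply`, `pauliString_mul_self`, `pauliString_const_I`),
  `PauliPathIntegral.lean` / `PauliPathOrthogonality.lean` (`strSign`,
  `pauliString_conj_eq_strSign_smul`, `sum_strSign_mul_strSign`, `eq_inv_smul_sum_pauliCoeff_smul`),
  `OutOfTimeOrderCorrelator.lean` (`strSign_comm`); Mathlib `Matrix.kronecker` (`mul_kronecker_mul`,
  `one_kronecker_one`).
-/

noncomputable section

open Matrix Finset
open scoped Kronecker

namespace Literature.InformationTheory.QuantumLearning.PauliChannelEstimation

open Literature.Computability.QuantumComplexity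
open Literature.Computability.QuantumComplexity.PauliPath
open Literature.Computability.QuantumComplexity.OTOC

variable {ι : Type*} [Fintype ι] [DecidableEq ι]

/-! ### Pauli channels, error rates and eigenvalues -/

/-- The **Pauli channel** with Pauli error rates `p`: `Λ(ρ) = Σ_a p_a P_a ρ P_a` (the Pauli strings of
the tree, `pauliString`, are Hermitian, so `P_a ρ P_a = P_a ρ P_a†`).
[cite: ChenZhouSeifJiang2022, eq. (1)] [cite: SeifEtAl2026, Methods §A eq. (10)] -/
def pauliChannel (p : (ι → Pauli) → ℂ) (ρ : Matrix (ι → Bool) (ι → Bool) ℂ) :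
    Matrix (ι → Bool) (ι → Bool) ℂ :=
  ∑ S, p S • (pauliString S * ρ * pauliString S)

/-- The **Pauli eigenvalues** (Pauli fidelities) `λ_b = Σ_a p_a (−1)^{⟨a,b⟩}` — the Walsh–Hadamard
transform of the error rates; `(−1)^{⟨a,b⟩}` is the tree's commutation sign `strSign a b`.
[cite: ChenZhouSeifJiang2022, eq. (3)] [cite: SeifEtAl2026, Methods §A eq. (12)] -/
def pauliEigenvalue (p : (ι → Pauli) → ℂ) (T : ι → Pauli) : ℂ :=
  ∑ S, p S * strSign S T

variable (p : (ι → Pauli) → ℂ)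

/-- Unfolding of `pauliChannel`. [cite: ChenZhouSeifJiang2022, eq. (1)] -/
theorem pauliChannel_eq (ρ : Matrix (ι → Bool) (ι → Bool) ℂ) :
    pauliChannel p ρ = ∑ S, p S • (pauliString S * ρ * pauliString S) := rfl

/-- Unfolding of `pauliEigenvalue`. [cite: ChenZhouSeifJiang2022, eq. (3)] -/
theorem pauliEigenvalue_eq (T : ι → Pauli) : pauliEigenvalue p T = ∑ S, p S * strSign S T := rfl

/-- **The Pauli strings are the eigen-operators of a Pauli channel**, with eigenvalues `λ_b`:
`Λ(P_b) = λ_b P_b` ("An important property of Pauli channels is that their eigen-operators are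
exactly the `4ⁿ` Pauli operators"). [cite: ChenZhouSeifJiang2022, eq. (2) and the sentence before it] -/
theorem pauliChannel_pauliString (T : ι → Pauli) :
    pauliChannel p (pauliString T) = pauliEigenvalue p T • pauliString T := by
  rw [pauliChannel_eq, pauliEigenvalue_eq, Finset.sum_smul]
  refine Finset.sum_congr rfl fun S _ => ?_
  rw [pauliString_conj_eq_strSign_smul, smul_smul]

/-- A Pauli channel is additive. [cite: ChenZhouSeifJiang2022, eq. (1)] -/
theorem pauliChannel_add (ρ σ : Matrix (ι → Bool) (ι → Bool) ℂ) :
    pauliChannel p (ρ + σ) = pauliChannel p ρ + pauliChannel p σ := by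
  simp only [pauliChannel_eq, Matrix.mul_add, Matrix.add_mul, smul_add, Finset.sum_add_distrib]

/-- A Pauli channel is homogeneous. [cite: ChenZhouSeifJiang2022, eq. (1)] -/
theorem pauliChannel_smul (c : ℂ) (ρ : Matrix (ι → Bool) (ι → Bool) ℂ) :
    pauliChannel p (c • ρ) = c • pauliChannel p ρ := by
  simp only [pauliChannel_eq, Matrix.mul_smul, Matrix.smul_mul, Finset.smul_sum, smul_comm c]

/-- A Pauli channel commutes with finite sums. [cite: ChenZhouSeifJiang2022, eq. (1)] -/
theorem pauliChannel_sum {κ : Type*} (s : Finset κ) (ρ : κ → Matrix (ι → Bool) (ι → Bool) ℂ) :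
    pauliChannel p (∑ k ∈ s, ρ k) = ∑ k ∈ s, pauliChannel p (ρ k) := by
  classical
  induction s using Finset.induction_on with
  | empty => simp [pauliChannel_eq]
  | insert a s ha ih => rw [Finset.sum_insert ha, Finset.sum_insert ha, pauliChannel_add, ih]

/-- **The eigenvalue form of a Pauli channel**: `Λ(ρ) = 2^{−n} Σ_b λ_b Tr(P_b ρ) P_b`.
[cite: ChenZhouSeifJiang2022, eq. (2)] [cite: SeifEtAl2026, Methods §A eq. (11)] -/
theorem pauliChannel_eq_sum_eigenvalue (ρ : Matrix (ι → Bool) (ι → Bool) ℂ) :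
    pauliChannel p ρ = ((2 : ℂ) ^ Fintype.card ι)⁻¹ •
      ∑ T, (pauliEigenvalue p T * pauliCoeff ρ T) • pauliString T := by
  conv_lhs => rw [eq_inv_smul_sum_pauliCoeff_smul ρ]
  rw [pauliChannel_smul, pauliChannel_sum]
  congr 1
  refine Finset.sum_congr rfl fun T _ => ?_
  rw [pauliChannel_smul, pauliChannel_pauliString, smul_smul, mul_comm]

/-- **Walsh–Hadamard inversion**: `p_a = 4^{−n} Σ_b λ_b (−1)^{⟨a,b⟩}` (character orthogonality of
the Pauli group, `Σ_b (−1)^{⟨a,b⟩}(−1)^{⟨a',b⟩} = 4ⁿ[a = a']`).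
[cite: ChenZhouSeifJiang2022, eq. (3)] [cite: SeifEtAl2026, Methods §A eq. (12)] -/
theorem walshHadamard_inversion (S : ι → Pauli) :
    ((4 : ℂ) ^ Fintype.card ι)⁻¹ * ∑ T, pauliEigenvalue p T * strSign S T = p S := by
  have h4 : ((4 : ℂ) ^ Fintype.card ι) ≠ 0 := pow_ne_zero _ (by norm_num)
  have hswap : ∑ T, pauliEigenvalue p T * strSign S T =
      ∑ S', p S' * ∑ T, strSign T S' * strSign T S := by
    simp only [pauliEigenvalue_eq, Finset.sum_mul, Finset.mul_sum]
    rw [Finset.sum_comm]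
    refine Finset.sum_congr rfl fun S' _ => Finset.sum_congr rfl fun T _ => ?_
    rw [strSign_comm S' T, strSign_comm S T]
    ring
  rw [hswap]
  simp only [sum_strSign_mul_strSign, mul_ite, mul_zero, Finset.sum_ite_eq', Finset.mem_univ,
    if_true]
  field_simp

/-- A Pauli channel with `Σ_a p_a = 1` preserves the trace. [cite: ChenZhouSeifJiang2022, eq. (1) ("a quantum channel of the following form")] -/
theorem trace_pauliChannel (hp : ∑ S, p S = 1) (ρ : Matrix (ι → Bool) (ι → Bool) ℂ) :
    (pauliChannel p ρ).trace = ρ.trace := by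
  rw [pauliChannel_eq, Matrix.trace_sum]
  simp only [Matrix.trace_smul, smul_eq_mul]
  have h : ∀ S : ι → Pauli, (pauliString S * ρ * pauliString S).trace = ρ.trace := fun S => by
    rw [Matrix.trace_mul_cycle, pauliString_mul_self, Matrix.one_mul]
  simp only [h, ← Finset.sum_mul, hp, one_mul]

/-! ### Bell pairs: the maximally entangled state and the Bell basis -/

/-- The **canonical Bell state** of `n` Bell pairs between the system register (first factor) and
an `n`-qubit memory (second factor), as a density matrix on the doubled register:
`Φ⁺ = |Φ⁺⟩⟨Φ⁺|`, `|Φ⁺⟩ = 2^{−n/2} Σ_j |j⟩|j⟩`, i.e. `Φ⁺_{(x₁,x₂),(y₁,y₂)} = 2^{−n}[x₁ = x₂][y₁ = y₂]`.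
[cite: SeifEtAl2026, Methods §A ("|Φ⟩ := Σ_j |jj⟩/√2ⁿ the (canonical) Bell state")] [cite: ChenZhouSeifJiang2022, eq. (4)] -/
def bellState : Matrix ((ι → Bool) × (ι → Bool)) ((ι → Bool) × (ι → Bool)) ℂ :=
  Matrix.of fun x y => if x.1 = x.2 ∧ y.1 = y.2 then (((2 : ℂ) ^ Fintype.card ι)⁻¹) else 0

omit [DecidableEq ι] in
/-- Entries of the Bell state. [cite: SeifEtAl2026, Methods §A] -/
theorem bellState_apply (x y : (ι → Bool) × (ι → Bool)) :
    bellState x y = if x.1 = x.2 ∧ y.1 = y.2 then (((2 : ℂ) ^ Fintype.card ι)⁻¹) else 0 := rfl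

/-- Summing over the diagonal of a doubled index. [folklore] -/
private theorem sum_prod_ite_eq {α : Type*} [Fintype α] [DecidableEq α] (g : α → α → ℂ) :
    ∑ y : α × α, (if y.1 = y.2 then g y.1 y.2 else 0) = ∑ a, g a a := by
  rw [Fintype.sum_prod_type]
  refine Finset.sum_congr rfl fun a _ => ?_
  simp only [Finset.sum_ite_eq, Finset.mem_univ, if_true]

/-- `Tr Φ⁺ = 1`. [cite: SeifEtAl2026, Methods §A] -/
theorem trace_bellState : (bellState : Matrix ((ι → Bool) × (ι → Bool)) _ ℂ).trace = 1 := by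
  classical
  simp only [Matrix.trace, Matrix.diag_apply, bellState_apply, and_self]
  rw [sum_prod_ite_eq (fun _ _ => (((2 : ℂ) ^ Fintype.card ι)⁻¹))]
  simp only [Finset.sum_const, Finset.card_univ, Fintype.card_fun, Fintype.card_bool,
    nsmul_eq_mul]
  push_cast
  exact mul_inv_cancel₀ (pow_ne_zero _ two_ne_zero)

/-- **The superdense-coding identity** behind the Bell probe: sandwiching a system operator between
two copies of the Bell state returns its normalised trace, `Φ⁺ (A ⊗ 1) Φ⁺ = 2^{−n} Tr(A) · Φ⁺`
(equivalently `⟨Φ⁺|A ⊗ 1|Φ⁺⟩ = Tr(A)/2ⁿ`). [cite: SeifEtAl2026, Supplementary §I.A (the superdense-coding paragraph and eq. (3))]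
[cite: ChenZhouSeifJiang2022, App. A eq. (A1)] -/
theorem bellState_mul_kronecker_one_mul_bellState (A : Matrix (ι → Bool) (ι → Bool) ℂ) :
    bellState * (A ⊗ₖ (1 : Matrix (ι → Bool) (ι → Bool) ℂ)) * bellState =
      ((((2 : ℂ) ^ Fintype.card ι)⁻¹) * A.trace) • bellState := by
  set c : ℂ := (((2 : ℂ) ^ Fintype.card ι)⁻¹) with hc
  ext x w
  -- the row `y ↦ (Φ (A ⊗ 1))_{x,z}`
  have inner : ∀ z : (ι → Bool) × (ι → Bool),
      ((bellState : Matrix ((ι → Bool) × (ι → Bool)) ((ι → Bool) × (ι → Bool)) ℂ) * (A ⊗ₖ (1 : Matrix (ι → Bool) (ι → Bool) ℂ))) x z =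
        (if x.1 = x.2 then c else 0) * A z.2 z.1 := by
    intro z
    rw [Matrix.mul_apply]
    have hterm : ∀ y : (ι → Bool) × (ι → Bool),
        bellState x y * (A ⊗ₖ (1 : Matrix (ι → Bool) (ι → Bool) ℂ)) y z =
          if y.1 = y.2 then (if x.1 = x.2 then c else 0) * (A y.1 z.1 * if y.2 = z.2 then 1 else 0)
            else 0 := by
      intro y
      rw [bellState_apply, Matrix.kronecker_apply, Matrix.one_apply]
      by_cases hx : x.1 = x.2 <;> by_cases hy : y.1 = y.2 <;> simp [hx, hy, hc]
    simp only [hterm]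
    rw [sum_prod_ite_eq (fun a b => (if x.1 = x.2 then c else 0) * (A a z.1 * if b = z.2 then 1 else 0))]
    simp only [mul_ite, mul_one, mul_zero, Finset.sum_ite_eq', Finset.mem_univ, if_true]
  rw [Matrix.mul_apply, Matrix.smul_apply, bellState_apply, smul_eq_mul]
  simp only [inner]
  have hterm2 : ∀ z : (ι → Bool) × (ι → Bool),
      (if x.1 = x.2 then c else 0) * A z.2 z.1 * bellState z w =
        if z.1 = z.2 then (if x.1 = x.2 then c else 0) * (if w.1 = w.2 then c else 0) * A z.2 z.1
          else 0 := by
    intro z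
    rw [bellState_apply, ← hc]
    by_cases hx : x.1 = x.2 <;> by_cases hz : z.1 = z.2 <;> by_cases hw : w.1 = w.2 <;>
      simp only [hx, hz, hw, and_self, and_true, and_false, if_true, if_false] <;> ring
  simp only [hterm2]
  rw [sum_prod_ite_eq (fun a b => (if x.1 = x.2 then c else 0) * (if w.1 = w.2 then c else 0) * A b a),
    ← Finset.mul_sum]
  simp only [Matrix.trace, Matrix.diag_apply]
  by_cases hx : x.1 = x.2 <;> by_cases hw : w.1 = w.2 <;> simp [hx, hw]
  ring

/-- `Φ⁺` is a projector: `Φ⁺ Φ⁺ = Φ⁺`. [cite: SeifEtAl2026, Methods §A] -/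
theorem bellState_mul_bellState :
    (bellState : Matrix ((ι → Bool) × (ι → Bool)) _ ℂ) * bellState = bellState := by
  classical
  have h := bellState_mul_kronecker_one_mul_bellState (ι := ι) 1
  rw [Matrix.one_kronecker_one, Matrix.mul_one, Matrix.trace_one, Fintype.card_fun,
    Fintype.card_bool] at h
  rw [h]
  have : (((2 : ℂ) ^ Fintype.card ι)⁻¹) * ((2 ^ Fintype.card ι : ℕ) : ℂ) = 1 := by
    push_cast
    exact inv_mul_cancel₀ (pow_ne_zero _ two_ne_zero)
  rw [this, one_smul]

/-- **Pauli expansion of the Bell state**: `Φ⁺ = 4^{−n} Σ_a P_a ⊗ P_aᵀ`.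
[cite: SeifEtAl2026, Supplementary §I.A eq. (3)] [cite: ChenZhouSeifJiang2022, App. A eq. (A1) (v = 0)] -/
theorem bellState_eq_sum_kronecker :
    (bellState : Matrix ((ι → Bool) × (ι → Bool)) _ ℂ) =
      (((4 : ℂ) ^ Fintype.card ι)⁻¹) • ∑ U : ι → Pauli, pauliString U ⊗ₖ (pauliString U)ᵀ := by
  ext ⟨x1, x2⟩ ⟨w1, w2⟩
  simp only [bellState_apply, Matrix.smul_apply, Matrix.sum_apply, Matrix.kronecker_apply,
    Matrix.transpose_apply, smul_eq_mul]
  rw [sum_pauliString_apply_mul_apply x1 w1 x2 w2]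
  have h4 : ((4 : ℂ) ^ Fintype.card ι) = (2 : ℂ) ^ Fintype.card ι * (2 : ℂ) ^ Fintype.card ι := by
    rw [← mul_pow]; norm_num
  by_cases h : x1 = x2 ∧ w1 = w2
  · rw [if_pos h, if_pos h, h4, mul_inv, mul_assoc, inv_mul_cancel₀ (pow_ne_zero _ two_ne_zero),
      mul_one]
  · rw [if_neg h, if_neg h, mul_zero]

/-- The **Bell basis** projectors `Φ_b = |Φ_b⟩⟨Φ_b|`, `|Φ_b⟩ = (P_b ⊗ I)|Φ⁺⟩`, indexed by the Pauli
strings `b`. [cite: SeifEtAl2026, Supplementary §I.A ("|Φ_b⟩ := P_b ⊗ I |Φ⁺⟩") and eq. (4)]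
[cite: ChenZhouSeifJiang2022, eq. (4)] -/
def bellBasis (T : ι → Pauli) : Matrix ((ι → Bool) × (ι → Bool)) ((ι → Bool) × (ι → Bool)) ℂ :=
  (pauliString T ⊗ₖ (1 : Matrix (ι → Bool) (ι → Bool) ℂ)) * bellState *
    (pauliString T ⊗ₖ (1 : Matrix (ι → Bool) (ι → Bool) ℂ))

/-- Unfolding of `bellBasis`. [cite: SeifEtAl2026, Supplementary §I.A eq. (4)] -/
theorem bellBasis_eq (T : ι → Pauli) :
    bellBasis T = (pauliString T ⊗ₖ (1 : Matrix (ι → Bool) (ι → Bool) ℂ)) * bellState *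
      (pauliString T ⊗ₖ (1 : Matrix (ι → Bool) (ι → Bool) ℂ)) := rfl

/-- `Φ_I = Φ⁺`. [cite: SeifEtAl2026, Supplementary §I.A] -/
theorem bellBasis_const_I : bellBasis (fun _ : ι => Pauli.I) = bellState := by
  rw [bellBasis_eq, pauliString_const_I, Matrix.one_kronecker_one, Matrix.one_mul, Matrix.mul_one]

/-- **Pauli expansion of the Bell basis**: `Φ_b = 4^{−n} Σ_a (−1)^{⟨a,b⟩} P_a ⊗ P_aᵀ`.
[cite: SeifEtAl2026, Supplementary §I.A eq. (4)] [cite: ChenZhouSeifJiang2022, App. A eq. (A1)] -/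
theorem bellBasis_eq_sum_kronecker (T : ι → Pauli) :
    bellBasis T = (((4 : ℂ) ^ Fintype.card ι)⁻¹) •
      ∑ U : ι → Pauli, strSign T U • (pauliString U ⊗ₖ (pauliString U)ᵀ) := by
  rw [bellBasis_eq, bellState_eq_sum_kronecker, Matrix.mul_smul, Matrix.smul_mul, Matrix.mul_sum,
    Finset.sum_mul]
  congr 1
  refine Finset.sum_congr rfl fun U _ => ?_
  rw [← Matrix.mul_kronecker_mul, ← Matrix.mul_kronecker_mul, Matrix.one_mul, Matrix.mul_one,
    pauliString_conj_eq_strSign_smul, Matrix.smul_kronecker]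

/-- Products of Bell-basis projectors: `Φ_b Φ_{b'} = [b = b'] (P_b ⊗ 1) Φ⁺ (P_{b'} ⊗ 1)` — the Bell
states `(P_b ⊗ I)|Φ⁺⟩` are orthonormal because `⟨Φ⁺|P_bP_{b'} ⊗ 1|Φ⁺⟩ = Tr(P_bP_{b'})/2ⁿ = [b = b']`.
[cite: SeifEtAl2026, Supplementary §I.A ("the four Bell states form an orthogonal basis … The orthogonality between different |Φ_b⟩ can be readily checked")]
[cite: ChenZhouSeifJiang2022, §II ("each P_a is mapped to a unique measurement outcome")] -/
theorem bellBasis_mul_bellBasis (T S : ι → Pauli) :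
    bellBasis T * bellBasis S = (if T = S then (1 : ℂ) else 0) •
      ((pauliString T ⊗ₖ (1 : Matrix (ι → Bool) (ι → Bool) ℂ)) * bellState *
        (pauliString S ⊗ₖ (1 : Matrix (ι → Bool) (ι → Bool) ℂ))) := by
  have key : bellState * ((pauliString T ⊗ₖ (1 : Matrix (ι → Bool) (ι → Bool) ℂ)) *
      (pauliString S ⊗ₖ (1 : Matrix (ι → Bool) (ι → Bool) ℂ))) * bellState =
        (if T = S then (1 : ℂ) else 0) • bellState := by
    rw [← Matrix.mul_kronecker_mul, Matrix.one_mul, bellState_mul_kronecker_one_mul_bellState,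
      trace_pauliString_mul_pauliString]
    congr 1
    split_ifs
    · exact inv_mul_cancel₀ (pow_ne_zero _ two_ne_zero)
    · exact mul_zero _
  calc bellBasis T * bellBasis S
      = (pauliString T ⊗ₖ (1 : Matrix (ι → Bool) (ι → Bool) ℂ)) *
          (bellState * ((pauliString T ⊗ₖ (1 : Matrix (ι → Bool) (ι → Bool) ℂ)) *
            (pauliString S ⊗ₖ (1 : Matrix (ι → Bool) (ι → Bool) ℂ))) * bellState) *
          (pauliString S ⊗ₖ (1 : Matrix (ι → Bool) (ι → Bool) ℂ)) := by
        simp only [bellBasis_eq, Matrix.mul_assoc]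
    _ = _ := by rw [key, Matrix.mul_smul, Matrix.smul_mul]

/-- **Orthonormality of the Bell basis in trace form**: `Tr(Φ_b Φ_{b'}) = [b = b']`.
[cite: SeifEtAl2026, Supplementary §I.A] [cite: ChenZhouSeifJiang2022, §II] -/
theorem trace_bellBasis_mul_bellBasis (T S : ι → Pauli) :
    (bellBasis T * bellBasis S).trace = if T = S then 1 else 0 := by
  rw [bellBasis_mul_bellBasis, Matrix.trace_smul, smul_eq_mul]
  split_ifs with h
  · subst h
    rw [Matrix.trace_mul_cycle, ← Matrix.mul_kronecker_mul, pauliString_mul_self, Matrix.one_mul,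
      Matrix.one_kronecker_one, Matrix.one_mul, trace_bellState, mul_one]
  · rw [zero_mul]

/-- Each `Φ_b` is a projector of trace one. [cite: SeifEtAl2026, Supplementary §I.A] -/
theorem bellBasis_mul_self (T : ι → Pauli) : bellBasis T * bellBasis T = bellBasis T := by
  rw [bellBasis_mul_bellBasis, if_pos rfl, one_smul, bellBasis_eq]

/-- `Tr Φ_b = 1`. [cite: SeifEtAl2026, Supplementary §I.A] -/
theorem trace_bellBasis (T : ι → Pauli) : (bellBasis T).trace = 1 := by
  rw [← bellBasis_mul_self, trace_bellBasis_mul_bellBasis, if_pos rfl]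

omit [DecidableEq ι] in
/-- The sign character of the identity string is `1`. [cite: ChenZhouSeifJiang2022, §II (⟨a, 0⟩ = 0)] -/
theorem strSign_const_I (T : ι → Pauli) : strSign T (fun _ => Pauli.I) = 1 := by
  rw [strSign_eq]
  exact Finset.prod_eq_one fun i _ => by simp [Pauli.sign]

/-- **Completeness of the Bell basis**: `Σ_b Φ_b = 1` on the doubled register (the `4ⁿ` Bell states
are an orthonormal basis). [cite: SeifEtAl2026, Methods §A ("forms a orthonormal basis for the 2n-qubit Hilbert space")]
[cite: ChenZhouSeifJiang2022, §II] -/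
theorem sum_bellBasis : ∑ T : ι → Pauli, bellBasis T =
    (1 : Matrix ((ι → Bool) × (ι → Bool)) ((ι → Bool) × (ι → Bool)) ℂ) := by
  have h4 : ((4 : ℂ) ^ Fintype.card ι) ≠ 0 := pow_ne_zero _ (by norm_num)
  simp only [bellBasis_eq_sum_kronecker]
  rw [← Finset.smul_sum, Finset.sum_comm]
  have hinner : ∀ U : ι → Pauli, ∑ T : ι → Pauli, strSign T U • (pauliString U ⊗ₖ (pauliString U)ᵀ) =
      (if U = fun _ => Pauli.I then ((4 : ℂ) ^ Fintype.card ι) else 0) •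
        (pauliString U ⊗ₖ (pauliString U)ᵀ) := by
    intro U
    rw [← Finset.sum_smul]
    congr 1
    have := sum_strSign_mul_strSign (ι := ι) U (fun _ => Pauli.I)
    simpa [strSign_const_I] using this
  simp only [hinner, ite_smul, zero_smul, Finset.sum_ite_eq', Finset.mem_univ, if_true, smul_smul,
    inv_mul_cancel₀ h4, one_smul, pauliString_const_I, Matrix.transpose_one, Matrix.one_kronecker_one]

/-! ### The channel acting on the system half, and the Bell-measurement outcome distribution -/

/-- `(Λ ⊗ id)(ρ)`: the Pauli channel applied to the system register of a state of system ⊗ memory.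
[cite: SeifEtAl2026, Supplementary §I.A eq. (5) (Λ_S ⊗ 1_A)] [cite: ChenZhouSeifJiang2022, eq. (8) (𝟙^A ⊗ Λ)] -/
def channelOnSystem (ρ : Matrix ((ι → Bool) × (ι → Bool)) ((ι → Bool) × (ι → Bool)) ℂ) :
    Matrix ((ι → Bool) × (ι → Bool)) ((ι → Bool) × (ι → Bool)) ℂ :=
  ∑ S, p S • ((pauliString S ⊗ₖ (1 : Matrix (ι → Bool) (ι → Bool) ℂ)) * ρ *
    (pauliString S ⊗ₖ (1 : Matrix (ι → Bool) (ι → Bool) ℂ)))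

/-- Unfolding of `channelOnSystem`. [cite: SeifEtAl2026, Supplementary §I.A eq. (5)] -/
theorem channelOnSystem_eq (ρ : Matrix ((ι → Bool) × (ι → Bool)) ((ι → Bool) × (ι → Bool)) ℂ) :
    channelOnSystem p ρ = ∑ S, p S • ((pauliString S ⊗ₖ (1 : Matrix (ι → Bool) (ι → Bool) ℂ)) * ρ *
      (pauliString S ⊗ₖ (1 : Matrix (ι → Bool) (ι → Bool) ℂ))) := rfl

omit [Fintype ι] [DecidableEq ι] in
/-- Finite sums pass through the first Kronecker factor. [folklore] -/
private theorem sum_kronecker {κ : Type*} (s : Finset κ)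
    (f : κ → Matrix (ι → Bool) (ι → Bool) ℂ) (B : Matrix (ι → Bool) (ι → Bool) ℂ) :
    (∑ k ∈ s, f k) ⊗ₖ B = ∑ k ∈ s, f k ⊗ₖ B := by
  classical
  induction s using Finset.induction_on with
  | empty => simp
  | insert a s ha ih => rw [Finset.sum_insert ha, Finset.sum_insert ha, Matrix.add_kronecker, ih]

/-- `channelOnSystem` IS `Λ ⊗ id` on product operators: `(Λ ⊗ id)(A ⊗ B) = Λ(A) ⊗ B`.
[cite: SeifEtAl2026, Supplementary §I.A eq. (5)] -/
theorem channelOnSystem_kronecker (A B : Matrix (ι → Bool) (ι → Bool) ℂ) :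
    channelOnSystem p (A ⊗ₖ B) = pauliChannel p A ⊗ₖ B := by
  rw [channelOnSystem_eq, pauliChannel_eq, sum_kronecker]
  refine Finset.sum_congr rfl fun S _ => ?_
  rw [← Matrix.mul_kronecker_mul, ← Matrix.mul_kronecker_mul, Matrix.one_mul, Matrix.mul_one,
    Matrix.smul_kronecker]

/-- Sending half of the Bell state through the channel produces the mixture `Σ_a p_a Φ_a` of Bell
basis states ("the Pauli channel can be viewed as randomly applying one of the `4ⁿ` Pauli operators
`P_a` with probability `p_a`, and each `P_a` is mapped to a unique measurement outcome").
[cite: ChenZhouSeifJiang2022, §II (Upper bounds)] [cite: SeifEtAl2026, Supplementary §I.A] -/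
theorem channelOnSystem_bellState :
    channelOnSystem p bellState = ∑ S : ι → Pauli, p S • bellBasis S := by
  simp only [channelOnSystem_eq, bellBasis_eq]

/-- **The Bell-measurement outcome distribution is the Pauli error distribution**:
`Pr[b] = Tr[Φ_b (Λ_S ⊗ 1_A)(Φ⁺)] = p_b` — with `n` Bell pairs and one Bell measurement one samples
`p` directly ("Comparing this to the Walsh-Hadamard transform, one can realize that Pr[b] is
exactly the Pauli error rates p of Λ"; Chen et al.'s outcome distribution (8) with a full `n`-qubit
ancilla). [cite: SeifEtAl2026, Supplementary §I.A eq. (5)] [cite: ChenZhouSeifJiang2022, eq. (8) (k = n) and §II] -/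
theorem trace_bellBasis_mul_channelOnSystem_bellState (T : ι → Pauli) :
    (bellBasis T * channelOnSystem p bellState).trace = p T := by
  rw [channelOnSystem_bellState, Matrix.mul_sum, Matrix.trace_sum]
  simp only [Matrix.mul_smul, Matrix.trace_smul, smul_eq_mul, trace_bellBasis_mul_bellBasis, mul_ite,
    mul_one, mul_zero, Finset.sum_ite_eq, Finset.mem_univ, if_true]

/-- **The eigenvalue estimator of the Bell protocol**: `λ_a = Σ_b (−1)^{⟨a,b⟩} Pr[b]`.
[cite: SeifEtAl2026, Supplementary §I.A eq. (6)] [cite: ChenZhouSeifJiang2022, §II ("construct an estimator for λ according to the Walsh-Hadamard transform")] -/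
theorem pauliEigenvalue_eq_sum_bellOutcome (T : ι → Pauli) :
    pauliEigenvalue p T = ∑ S : ι → Pauli,
      strSign T S * (bellBasis S * channelOnSystem p bellState).trace := by
  simp only [trace_bellBasis_mul_channelOnSystem_bellState, pauliEigenvalue_eq]
  exact Finset.sum_congr rfl fun S _ => by rw [strSign_comm, mul_comm]

/-- The outcome weights form a probability distribution whenever `p` does:
`Σ_b Tr[Φ_b (Λ ⊗ 1)(Φ⁺)] = Σ_b p_b`. [cite: SeifEtAl2026, Supplementary §I.A eq. (5)] -/
theorem sum_trace_bellBasis_mul_channelOnSystem_bellState :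
    ∑ T : ι → Pauli, (bellBasis T * channelOnSystem p bellState).trace = ∑ T, p T := by
  simp only [trace_bellBasis_mul_channelOnSystem_bellState]

end Literature.InformationTheory.QuantumLearning.PauliChannelEstimation
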